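import Literature.MathematicalPhysics.QuantumLattice.HubbardOneBodyKinematicRows
import HarnessLib

/-!
# The band-bottom floor of the `t–t'` Hubbard energy density: `ε_min · n ≤ e(t, t', U, n)`

Topic `MathematicalPhysics/QuantumLattice` (family `hubbard`); a one-screen corollary of the tree's bathtub (free
Fermi-sea) floor `energyDensityTT'_ge_bathtub` (`HubbardOneBodyKinematicRows` §3: for `U ≥ 0`, `0 ≤ n < 2` and EVERY
chemical potential `μ`, `μ n + 2 (2π)⁻² ∫_{[-π,π]²} min(ε(p) − μ, 0) dp ≤ e(t, t', U, n)` with the corner-written band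
`ε(p) = 2t(cos p₁ + cos p₂) − 4t' cos p₁ cos p₂`). Taking `μ` AT THE BOTTOM OF THE BAND makes the integrand vanish
identically, leaving the elementary floor «every electron costs at least the band minimum, the repulsion is nonnegative»:

* `ttPrimeCornerBand_sub_bandBottom_nonneg` — for `t ≥ 0`, `t' ≥ −t/2` and all `x, y`:
  `2t(cos x + cos y) − 4t' cos x cos y + 4(t + t') = 2t(1 + cos x)(1 + cos y) + (2t + 4t')(1 − cos x cos y) ≥ 0`,
  i.e. the band minimum is `ε_min = −4(t + t')` (attained at `cos x = cos y = −1`);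
* **`neg_four_mul_add_mul_le_energyDensityTT'`** — `t ≥ 0`, `−t/2 ≤ t'`, `U ≥ 0`, `0 ≤ n < 2`:
  `−4(t + t')·n ≤ e(t, t', U, n)`; the `t = 1` form `neg_four_mul_one_add_mul_le_energyDensityTT'`
  (`−4(1 + t')·n ≤ e(1, t', U, n)` for `t' ≥ −1/2` — the cuprate / nickelate boxes have `t' ∈ [−0.55, 0]`);
* `four_mul_mul_le_energyDensityTT'` — the other regime `t ≥ 0`, `t' ≤ −t/2`: there the diagonal term wins, the band
  minimum is `4t'` (attained at `cos x = −cos y = ±1`), floor `4t'·n ≤ e(t, t', U, n)`;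
* `neg_four_mul_add_abs_mul_le_energyDensityTT'` — the regime-free envelope `−4(t + |t'|)·n ≤ e(t, t', U, n)` (`t ≥ 0`).

WHY (cell `pub/hubbard-obs` ∧ `pub/hubbard-downfold`, D-0154 (1)(C) coverage routes): the f-sum station certificates of the
venture are keyed with an IDLE floor row `lo = ε_min · n₀` («band bottom × density, idle by construction», e.g.
`−12879/6250 = −4(1 − 23/50)·(477/500)` at the NdNiO₂ corner), so far discharged through a separate certified energy-floor
node at the anchor density only; this file discharges that premise at EVERY density, source `t'` and coupling `U ≥ 0`
with no certificate at all, and supplies the floor TABLE the density-parametrised (WN / affine-N) row readers ask for.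

WHAT THIS IS NOT: a sharp floor (the free Fermi sea `−16/π² ≈ −1.62` at `t' = 0`, `n = 1` is far above `ε_min = −4`);
a statement for `t < 0` (use the hopping-sign symmetries of `HubbardHoppingFamilyLatticeSymmetry` if ever needed); a number
about any material. Everything is PROVED; no definition, no named fact, zero compute.

## Mathlib / tree search

REUSED: `energyDensityTT'_ge_bathtub` (HubbardOneBodyKinematicRows §3), Mathlib `Real.neg_one_le_cos`, `Real.cos_le_one`,
`min_eq_right`, `MeasureTheory.integral_zero`; two private `nlinarith` helpers (`1 ± ab ≥ 0` on `[−1, 1]²`). `lean search 'bandBottom|band_bottom'`: only the finite-torus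
`HubbardBandBottom*` files of route ParityLeeYang (plane-wave modes, no TL energy-density floor) (2026-08-28).

## References

* E. H. Lieb, M. Loss, Duke Math. J. 71 (1993) 337, §8, Theorem 8.2 (bathtub / sum of negative eigenvalues).
  [cite: LiebLoss1993, §8, Theorem 8.2]
* D. Ruelle, *Statistical Mechanics: Rigorous Results* (1969), §3.4 (one-particle energy band bounds the energy per
  particle). [cite: Ruelle1969, §3.4]
-/

noncomputable section

namespace Literature.MathematicalPhysics.QuantumLattice

open Matrix Finset HubbardWave0 Literature.Probability.LatticeModels ThermodynamicLimit
open _root_.Filter Real Set MeasureTheory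
open scoped _root_.Topology ComplexOrder BigOperators

/-! ### §1 The band minimum -/

/-- For `|a| ≤ 1`, `|b| ≤ 1`: `1 − a·b = ((1 − a)(1 + b) + (1 + a)(1 − b))/2 ≥ 0` (private helper). [folklore] -/
private theorem one_sub_mul_nonneg_of_abs_le_one {a b : ℝ} (ha₁ : -1 ≤ a) (ha₂ : a ≤ 1) (hb₁ : -1 ≤ b) (hb₂ : b ≤ 1) :
    0 ≤ 1 - a * b := by
  nlinarith [mul_nonneg (by linarith : (0 : ℝ) ≤ 1 - a) (by linarith : (0 : ℝ) ≤ 1 + b),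
    mul_nonneg (by linarith : (0 : ℝ) ≤ 1 + a) (by linarith : (0 : ℝ) ≤ 1 - b)]

/-- For `|a| ≤ 1`, `|b| ≤ 1`: `0 ≤ 1 + a·b` (private helper). [folklore] -/
private theorem one_add_mul_nonneg_of_abs_le_one {a b : ℝ} (ha₁ : -1 ≤ a) (ha₂ : a ≤ 1) (hb₁ : -1 ≤ b) (hb₂ : b ≤ 1) :
    0 ≤ 1 + a * b := by
  nlinarith [mul_nonneg (by linarith : (0 : ℝ) ≤ 1 - a) (by linarith : (0 : ℝ) ≤ 1 - b),
    mul_nonneg (by linarith : (0 : ℝ) ≤ 1 + a) (by linarith : (0 : ℝ) ≤ 1 + b)]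

/-- **The corner-written `t–t'` band sits above `−4(t + t')` when `t ≥ 0`, `t' ≥ −t/2`**: for all `x, y`,
`0 ≤ 2t(cos x + cos y) − 4t'(cos x cos y) − (−4(t + t'))`, by the identity
`= 2t(1 + cos x)(1 + cos y) + (2t + 4t')(1 − cos x cos y)`. (The minimum `−4(t + t')` is attained at `cos x = cos y = −1`,
the physical band bottom `ε_phys(0,0) = −4t − 4t'`; the one-particle band of the lattice gas.) [cite: Ruelle1969, §3.4] -/
theorem ttPrimeCornerBand_sub_bandBottom_nonneg {t t' : ℝ} (ht : 0 ≤ t) (ht' : -t / 2 ≤ t') (x y : ℝ) :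
    0 ≤ 2 * t * (Real.cos x + Real.cos y) - 4 * t' * (Real.cos x * Real.cos y) - -(4 * (t + t')) := by
  have hx1 := Real.neg_one_le_cos x
  have hx2 := Real.cos_le_one x
  have hy1 := Real.neg_one_le_cos y
  have hy2 := Real.cos_le_one y
  have h1 : 0 ≤ (1 + Real.cos x) * (1 + Real.cos y) := mul_nonneg (by linarith) (by linarith)
  have h2 : 0 ≤ 1 - Real.cos x * Real.cos y := one_sub_mul_nonneg_of_abs_le_one hx1 hx2 hy1 hy2
  have h3 : (0 : ℝ) ≤ 2 * t + 4 * t' := by linarith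
  have key : 2 * t * (Real.cos x + Real.cos y) - 4 * t' * (Real.cos x * Real.cos y) - -(4 * (t + t')) =
      2 * t * ((1 + Real.cos x) * (1 + Real.cos y)) + (2 * t + 4 * t') * (1 - Real.cos x * Real.cos y) := by ring
  rw [key]
  exact add_nonneg (mul_nonneg (by linarith) h1) (mul_nonneg h3 h2)

/-- **The other regime `t ≥ 0`, `t' ≤ −t/2`: the band sits above `4t'`** — for all `x, y`,
`0 ≤ 2t(cos x + cos y) − 4t'(cos x cos y) − 4t'`, since `−4t'(1 + cos x cos y) ≥ 2t(1 + cos x cos y)` and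
`2t(cos x + cos y) + 2t(1 + cos x cos y) = 2t(1 + cos x)(1 + cos y) ≥ 0` (minimum `4t'` at `cos x = −cos y = ±1`; the
one-particle band of the lattice gas). [cite: Ruelle1969, §3.4] -/
theorem ttPrimeCornerBand_sub_fourMul_nonneg {t t' : ℝ} (ht : 0 ≤ t) (ht' : t' ≤ -t / 2) (x y : ℝ) :
    0 ≤ 2 * t * (Real.cos x + Real.cos y) - 4 * t' * (Real.cos x * Real.cos y) - 4 * t' := by
  have hx1 := Real.neg_one_le_cos x
  have hx2 := Real.cos_le_one x
  have hy1 := Real.neg_one_le_cos y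
  have hy2 := Real.cos_le_one y
  have h1 : 0 ≤ (1 + Real.cos x) * (1 + Real.cos y) := mul_nonneg (by linarith) (by linarith)
  have h2 : 0 ≤ 1 + Real.cos x * Real.cos y := one_add_mul_nonneg_of_abs_le_one hx1 hx2 hy1 hy2
  have h3 : (0 : ℝ) ≤ -(4 * t') - 2 * t := by linarith
  have key : 2 * t * (Real.cos x + Real.cos y) - 4 * t' * (Real.cos x * Real.cos y) - 4 * t' =
      2 * t * ((1 + Real.cos x) * (1 + Real.cos y)) + (-(4 * t') - 2 * t) * (1 + Real.cos x * Real.cos y) := by ring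
  rw [key]
  exact add_nonneg (mul_nonneg (by linarith) h1) (mul_nonneg h3 h2)

/-! ### §2 The floors -/

/-- **Band-bottom floor, `t ≥ 0`, `t' ≥ −t/2`: `−4(t + t')·n ≤ e(t, t', U, n)`** for `U ≥ 0`, `0 ≤ n < 2` — the bathtub
floor `energyDensityTT'_ge_bathtub` at `μ = −4(t + t')`, where the integrand `min(ε(p) − μ, 0)` vanishes identically.
[cite: LiebLoss1993, §8, Theorem 8.2] -/
theorem neg_four_mul_add_mul_le_energyDensityTT' {t t' : ℝ} (ht : 0 ≤ t) (ht' : -t / 2 ≤ t') {U : ℝ} (hU : 0 ≤ U)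
    {n : ℝ} (hn0 : 0 ≤ n) (hn2 : n < 2) :
    -(4 * (t + t')) * n ≤ energyDensityTT' t t' U n := by
  have h := energyDensityTT'_ge_bathtub t t' hU hn0 hn2 (-(4 * (t + t')))
  have h0 : ∀ p : Fin 2 → ℝ,
      min (2 * t * (Real.cos (p 0) + Real.cos (p 1)) - 4 * t' * (Real.cos (p 0) * Real.cos (p 1)) - -(4 * (t + t'))) 0 = 0 :=
    fun p => min_eq_right (ttPrimeCornerBand_sub_bandBottom_nonneg ht ht' (p 0) (p 1))
  simp only [h0, integral_zero, mul_zero, add_zero] at h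
  exact h

/-- **The `t = 1` form used by the venture's boxes: `−4(1 + t')·n ≤ e(1, t', U, n)`** for `t' ≥ −1/2`, `U ≥ 0`,
`0 ≤ n < 2` (e.g. `t' = −23/50`: `−(54/25)·n`; at `n = 477/500` this is `−12879/6250`, the idle floor row of the NdNiO₂
station certificates). [cite: LiebLoss1993, §8, Theorem 8.2] -/
theorem neg_four_mul_one_add_mul_le_energyDensityTT' {t' : ℝ} (ht' : -1 / 2 ≤ t') {U : ℝ} (hU : 0 ≤ U)
    {n : ℝ} (hn0 : 0 ≤ n) (hn2 : n < 2) :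
    -(4 * (1 + t')) * n ≤ energyDensityTT' 1 t' U n :=
  neg_four_mul_add_mul_le_energyDensityTT' zero_le_one (by linarith) hU hn0 hn2

/-- **Band-bottom floor, `t ≥ 0`, `t' ≤ −t/2`: `4t'·n ≤ e(t, t', U, n)`** for `U ≥ 0`, `0 ≤ n < 2` (bathtub at `μ = 4t'`).
[cite: LiebLoss1993, §8, Theorem 8.2] -/
theorem four_mul_mul_le_energyDensityTT' {t t' : ℝ} (ht : 0 ≤ t) (ht' : t' ≤ -t / 2) {U : ℝ} (hU : 0 ≤ U)
    {n : ℝ} (hn0 : 0 ≤ n) (hn2 : n < 2) :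
    4 * t' * n ≤ energyDensityTT' t t' U n := by
  have h := energyDensityTT'_ge_bathtub t t' hU hn0 hn2 (4 * t')
  have h0 : ∀ p : Fin 2 → ℝ,
      min (2 * t * (Real.cos (p 0) + Real.cos (p 1)) - 4 * t' * (Real.cos (p 0) * Real.cos (p 1)) - 4 * t') 0 = 0 :=
    fun p => min_eq_right (ttPrimeCornerBand_sub_fourMul_nonneg ht ht' (p 0) (p 1))
  simp only [h0, integral_zero, mul_zero, add_zero] at h
  exact h

/-- **Regime-free envelope: `−4(t + |t'|)·n ≤ e(t, t', U, n)`** for `t ≥ 0`, `U ≥ 0`, `0 ≤ n < 2` and EVERY `t'` (the two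
regimes glued: `−4(t + |t'|) ≤ −4(t + t')` and `≤ 4t'` respectively) — the `T = 0` trace of the lattice-gas band
`[−(4|t| + 4|t'|), 4|t| + 4|t'| + U]` of `HubbardTTPrimeChemicalPotentialBand`. [cite: Ruelle1969, §3.4] -/
theorem neg_four_mul_add_abs_mul_le_energyDensityTT' {t : ℝ} (ht : 0 ≤ t) (t' : ℝ) {U : ℝ} (hU : 0 ≤ U)
    {n : ℝ} (hn0 : 0 ≤ n) (hn2 : n < 2) :
    -(4 * (t + |t'|)) * n ≤ energyDensityTT' t t' U n := by
  rcases le_total (-t / 2) t' with h | h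
  · have h1 := neg_four_mul_add_mul_le_energyDensityTT' ht h hU hn0 hn2
    have h2 : -(4 * (t + |t'|)) * n ≤ -(4 * (t + t')) * n :=
      mul_le_mul_of_nonneg_right (by linarith [le_abs_self t']) hn0
    exact h2.trans h1
  · have h1 := four_mul_mul_le_energyDensityTT' ht h hU hn0 hn2
    have ht'0 : t' ≤ 0 := by linarith
    have habs : |t'| = -t' := abs_of_nonpos ht'0
    have h2 : -(4 * (t + |t'|)) * n ≤ 4 * t' * n :=
      mul_le_mul_of_nonneg_right (by rw [habs]; linarith) hn0
    exact h2.trans h1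

/-- **Monotone-in-density reading** (what a density-INTERVAL reader uses): for `t ≥ 0`, `t' ≥ −t/2` the floor
`−4(t + t')·x` is antitone in `x` (its slope `−4(t + t') ≤ 0`), so the floor row keyed at an anchor density `n₀`,
`lo = −4(t + t')·n₀`, is implied at EVERY density `x ≤ n₀` of `[0, 2)`: `lo ≤ −4(t + t')·x ≤ e(t, t', U, x)` (the band-bottom
floor of the energy per site, read below the anchor). [cite: Ruelle1969, §3.4] -/
theorem neg_four_mul_add_mul_anchor_le_energyDensityTT' {t t' : ℝ} (ht : 0 ≤ t) (ht' : -t / 2 ≤ t') {U : ℝ} (hU : 0 ≤ U)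
    {x n₀ : ℝ} (hx0 : 0 ≤ x) (hx2 : x < 2) (hxn : x ≤ n₀) :
    -(4 * (t + t')) * n₀ ≤ energyDensityTT' t t' U x := by
  have h1 := neg_four_mul_add_mul_le_energyDensityTT' ht ht' hU hx0 hx2
  have h2 : -(4 * (t + t')) * n₀ ≤ -(4 * (t + t')) * x := by nlinarith
  exact h2.trans h1

end Literature.MathematicalPhysics.QuantumLattice

end
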